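import Summits.BirchSwinnertonDyer.BirchSwinnertonDyer.Theorems.ResidualThetaTransportAtTwoThetaLayerLambdaCongruenceAtTwoCuspSpanTwoPrimesPotential
import HarnessLib

/-!
# Route `ResidualThetaTransportAtTwo`, cruxes Kan⁺ (stmt-BirchSwinnertonDyer-20688) / node 27436 / 21437: **`B₁`-GENERATION
# MOD 2 AT THE SQUAREFREE TWO-PRIME LEVELS** — an additive `χ : Γ₀(pq) → 𝔽₂` killing the trace-`±2` elements and
# `B₁ = {b = −1}` is ZERO (`p ≠ q` primes)

Cell `bsd-wall`, lead prover `bsd-wall-rtt-p3` g10 (2026-08-28). THEOREMS ONLY (no `def`, no `sorry`);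
`--supports stmt-BirchSwinnertonDyer-20688`; BSD is not proved by this. Sequel to `…CuspSpanPotential` (the engine) and `…CuspSpanTwoPrimesPotential` (§1, the potential at level `pq`).

This is the composite-level replacement for the prime-power descent `chi_eq_zero_of_forall_b1` of `…CuspSpanGenerationB1`
(which needs (SUCC): of two consecutive integers one is a unit mod `N` — false at `N = pq`). The group-theoretic statement
«`Γ₀(pq)` is generated by its parabolics and `B₁`» (the lead's Lemma P, `Lines/birth-generation.md` §3.3) is NOT proved; only
its `𝔽₂`-shadow, which is what the node needs:

* (§1, previous file) a POTENTIAL `φ` with `φ(γ v) = χ γ + φ v` and `φ(e) = 0` at the four base vectors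
  `(0,1), (1,0), (1,p), (1,q)` exists (`exists_potential_twoPrimes`).
* §2 THE CHAIN: `φ(1, x) = 0` for `p ∣ x`, `q ∤ x` — the `B₁`-move `x ↦ x/(x+1)` of the engine raises `x⁻¹ mod q` by `1`, so the
  `q − 1` type-`p` classes form ONE chain anchored at `x = p` (`phi_one_eq_zero_of_dvd_left`); symmetrically for `q`; with the
  unit classes (`B₁`) and the class `0` (`L_w`): `φ(1, w) = 0` for EVERY `w` (`phi_one_eq_zero_twoPrimes`).
* §3 THE SYMBOL FUNCTION VANISHES: `φ(col₀ g) = φ(col₁ g)` for every `g ∈ SL₂(ℤ)` — rows with `d` or `c` prime to `N` by the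
  engine, the MIXED rows (`p ∣ d, q ∣ c` or conversely: the only two bad points of `P¹(ℤ/pq) = P¹(𝔽_p) × P¹(𝔽_q)`) by the triangle
  through `−c−d`, which is prime to `N` (`phi_col_eq_twoPrimes`).
* §4 **`chi_eq_zero_of_forall_b_neg_one_twoPrimes`**: `χ ≡ 0` (engine §4: `SL₂(ℤ) = ⟨S, T⟩`).

Counting shows why three primes need more: `φ(105)/2 = 24 < 26 = 2g(X₀(105))`, so the `B₁`-loops cannot span
`H₁(X₀(105); 𝔽₂)` and the analogue of §3 fails (a mixed row `(p ∣ d, q ∣ c)` may have `r ∣ c + d`).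

References: [Manin1972] §1.5–1.7; [Rademacher1929] §1; [Knapp1993] Prop. 11.1; [Pollack2003] Conj. 6.3.
-/

set_option autoImplicit false
set_option linter.dupNamespace false

noncomputable section

open scoped MatrixGroups

open CongruenceSubgroup Literature.NumberTheory.EllipticCurves.ModularForms

namespace Summit.BirchSwinnertonDyer.BirchSwinnertonDyer.Theorems.SignedMuAtTwo

namespace Potential

variable {p q N : ℕ} {χ : Gamma0 N → ZMod 2} {φ : ℤ → ℤ → ZMod 2}

/-! ## §2. The chain on the type-`p` residues: `φ(1, w) = 0` for every `w` -/

/-- Type-`p` residues with the same image in `ZMod q` have the same `φ(1, ·)` (they are congruent mod `N`). [folklore] -/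
theorem phi_one_eq_of_dvd_of_cast_eq (hp : p.Prime) (hq : q.Prime) (hpq : p ≠ q) (hN : N = p * q)
    (hsmall : ∀ γ : Gamma0 N, ((γ : SL(2, ℤ)) 0 0 + (γ : SL(2, ℤ)) 1 1).natAbs ≤ 2 → χ γ = 0)
    (hφ : ∀ (γ : Gamma0 N) (x y : ℤ), IsCoprime x y →
      φ ((γ : SL(2, ℤ)) 0 0 * x + (γ : SL(2, ℤ)) 0 1 * y) ((γ : SL(2, ℤ)) 1 0 * x + (γ : SL(2, ℤ)) 1 1 * y) = χ γ + φ x y)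
    {x x' : ℤ} (hx : (p : ℤ) ∣ x) (hx' : (p : ℤ) ∣ x') (h : (x : ZMod q) = (x' : ZMod q)) : φ 1 x = φ 1 x' :=
  phi_one_eq_of_dvd_sub hsmall hφ (dvd_level_of_dvd_dvd hp hq hpq hN (dvd_sub hx hx')
    ((ZMod.intCast_eq_intCast_iff_dvd_sub x' x q).mp h.symm))

/-- **The step of the chain.** For a type-`p` integer `x` (`p ∣ x`, `x s = 1` in `ZMod q`) with `s + 1 ≠ 0` there is a type-`p`
integer `x₂` with `x₂ (s + 1) = 1` in `ZMod q` and `φ(1, x₂) = φ(1, x)`: `x₂ = 1 − u` with `(x+1)u + Nk = 1` (engine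
`phi_one_one_sub_eq`). [cite: Manin1972, §1.6] -/
theorem exists_step_typeP [Fact q.Prime] (hp : p.Prime) (hq : q.Prime) (hN : N = p * q)
    (hφ : ∀ (γ : Gamma0 N) (x y : ℤ), IsCoprime x y →
      φ ((γ : SL(2, ℤ)) 0 0 * x + (γ : SL(2, ℤ)) 0 1 * y) ((γ : SL(2, ℤ)) 1 0 * x + (γ : SL(2, ℤ)) 1 1 * y) = χ γ + φ x y)
    (hB1 : ∀ β : Gamma0 N, (β : SL(2, ℤ)) 0 1 = -1 → χ β = 0)
    {x : ℤ} {s : ZMod q} (hx : (p : ℤ) ∣ x) (hs : (x : ZMod q) * s = 1) (hs1 : s + 1 ≠ 0) :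
    ∃ x₂ : ℤ, (p : ℤ) ∣ x₂ ∧ (x₂ : ZMod q) * (s + 1) = 1 ∧ φ 1 x₂ = φ 1 x := by
  -- `x + 1` is prime to `N`
  have hq1 : ¬ (q : ℤ) ∣ x + 1 := by
    intro h
    have h0 : ((x + 1 : ℤ) : ZMod q) = 0 := (ZMod.intCast_zmod_eq_zero_iff_dvd _ q).mpr h
    push_cast at h0
    apply hs1
    -- `x = -1`, so `s = x s · (-1) = -1`
    have hx1 : (x : ZMod q) = -1 := by linear_combination h0
    rw [hx1] at hs
    linear_combination -hs
  have hcop : IsCoprime (x + 1) (N : ℤ) := isCoprime_level_of_not_dvd hp hq hN (not_dvd_add_one_of_dvd hp hx) hq1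
  obtain ⟨u, k, huk⟩ := hcop
  have huk' : (x + 1) * u + N * k = 1 := by linear_combination huk
  refine ⟨1 - u, ?_, ?_, phi_one_one_sub_eq hφ hB1 huk'⟩
  · -- `1 - u = x u + N k`
    have e : 1 - u = x * u + N * k := by linear_combination -1 * huk'
    rw [e]
    exact dvd_add (dvd_mul_of_dvd_left hx u) (dvd_mul_of_dvd_left (Int.natCast_dvd_natCast.mpr (hN ▸ dvd_mul_right p q)) k)
  · have hNq : ((N : ℕ) : ZMod q) = 0 := by
      rw [hN, Nat.cast_mul, ZMod.natCast_self, mul_zero]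
    have hu : ((x : ZMod q) + 1) * (u : ZMod q) = 1 := by
      have := congrArg (fun z : ℤ ↦ (z : ZMod q)) huk'
      push_cast at this
      rw [hNq, zero_mul, add_zero] at this
      exact this
    push_cast
    linear_combination (-s) * hu + (u : ZMod q) * hs

/-- A type-`p` integer with prescribed inverse `s ≠ 0` in `ZMod q`: `x = p · t` with `t ≡ (p s)⁻¹`. [folklore] -/
theorem exists_typeP_of_ne_zero [Fact q.Prime] (hp : p.Prime) (hq : q.Prime) (hpq : p ≠ q) {s : ZMod q} (hs : s ≠ 0) :
    ∃ x : ℤ, (p : ℤ) ∣ x ∧ (x : ZMod q) * s = 1 := by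
  have hp0 : (p : ZMod q) ≠ 0 := by
    rw [Ne, ZMod.natCast_eq_zero_iff]
    exact fun h ↦ hpq ((Nat.prime_dvd_prime_iff_eq hq hp).mp h).symm
  refine ⟨p * ((((p : ZMod q) * s)⁻¹).val : ℤ), dvd_mul_right _ _, ?_⟩
  push_cast
  rw [ZMod.natCast_zmod_val, mul_assoc, mul_comm _ s, ← mul_assoc]
  exact mul_inv_cancel₀ (mul_ne_zero hp0 hs)

/-- **The chain.** All type-`p` classes have the same `φ(1, ·)`: by induction on `val(x⁻¹ mod q)`, each class is linked to the
class with inverse one less by the step, down to the class with inverse `1`. [cite: Manin1972, §1.6] -/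
theorem phi_one_typeP_eq_of_val [Fact q.Prime] (hp : p.Prime) (hq : q.Prime) (hpq : p ≠ q) (hN : N = p * q)
    (hsmall : ∀ γ : Gamma0 N, ((γ : SL(2, ℤ)) 0 0 + (γ : SL(2, ℤ)) 1 1).natAbs ≤ 2 → χ γ = 0)
    (hφ : ∀ (γ : Gamma0 N) (x y : ℤ), IsCoprime x y →
      φ ((γ : SL(2, ℤ)) 0 0 * x + (γ : SL(2, ℤ)) 0 1 * y) ((γ : SL(2, ℤ)) 1 0 * x + (γ : SL(2, ℤ)) 1 1 * y) = χ γ + φ x y)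
    (hB1 : ∀ β : Gamma0 N, (β : SL(2, ℤ)) 0 1 = -1 → χ β = 0)
    {x₁ : ℤ} (hx₁ : (p : ℤ) ∣ x₁) (hs₁ : (x₁ : ZMod q) * 1 = 1) :
    ∀ (k : ℕ) (x : ℤ) (s : ZMod q), (p : ℤ) ∣ x → (x : ZMod q) * s = 1 → s.val = k + 1 → φ 1 x = φ 1 x₁ := by
  intro k
  induction k with
  | zero =>
    intro x s hx hs hval
    have hs' : s = 1 := by
      apply ZMod.val_injective
      rw [hval, ZMod.val_one]
    rw [hs'] at hs
    refine phi_one_eq_of_dvd_of_cast_eq hp hq hpq hN hsmall hφ hx hx₁ ?_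
    rw [mul_one] at hs hs₁
    rw [hs, hs₁]
  | succ k ih =>
    intro x s hx hs hval
    -- the predecessor class: inverse `s - 1 ≠ 0`
    have hs0 : s ≠ 0 := by rintro rfl; rw [mul_zero] at hs; exact zero_ne_one hs
    have hle : (1 : ZMod q).val ≤ s.val := by rw [ZMod.val_one, hval]; omega
    have hval' : (s - 1).val = k + 1 := by rw [ZMod.val_sub hle, hval, ZMod.val_one, Nat.add_sub_cancel]
    have hs'0 : s - 1 ≠ 0 := by
      intro h
      have := congrArg ZMod.val h
      rw [hval', ZMod.val_zero] at this
      omega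
    obtain ⟨x', hx', hxs'⟩ := exists_typeP_of_ne_zero hp hq hpq hs'0
    obtain ⟨x₂, hx₂, hx₂s, hφ₂⟩ := exists_step_typeP hp hq hN hφ hB1 hx' hxs' (by rw [sub_add_cancel]; exact hs0)
    rw [sub_add_cancel] at hx₂s
    -- `x ≡ x₂ (mod q)`: both are inverses of `s`
    have hxx₂ : (x : ZMod q) = (x₂ : ZMod q) := by
      have : ((x : ZMod q) - x₂) * s = 0 := by rw [sub_mul, hs, hx₂s, sub_self]
      exact sub_eq_zero.mp ((mul_eq_zero.mp this).resolve_right hs0)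
    rw [phi_one_eq_of_dvd_of_cast_eq hp hq hpq hN hsmall hφ hx hx₂ hxx₂, hφ₂]
    exact ih x' (s - 1) hx' hxs' hval'

/-- **`φ(1, x) = 0` for the type-`p` residues** (`p ∣ x`, `q ∤ x`) at level `pq`, given the anchor `φ(1, p) = 0`.
[cite: Manin1972, §1.6] -/
theorem phi_one_eq_zero_of_dvd_left (hp : p.Prime) (hq : q.Prime) (hpq : p ≠ q) (hN : N = p * q)
    (hsmall : ∀ γ : Gamma0 N, ((γ : SL(2, ℤ)) 0 0 + (γ : SL(2, ℤ)) 1 1).natAbs ≤ 2 → χ γ = 0)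
    (hφ : ∀ (γ : Gamma0 N) (x y : ℤ), IsCoprime x y →
      φ ((γ : SL(2, ℤ)) 0 0 * x + (γ : SL(2, ℤ)) 0 1 * y) ((γ : SL(2, ℤ)) 1 0 * x + (γ : SL(2, ℤ)) 1 1 * y) = χ γ + φ x y)
    (hB1 : ∀ β : Gamma0 N, (β : SL(2, ℤ)) 0 1 = -1 → χ β = 0) (h1p : φ 1 p = 0)
    {x : ℤ} (hx : (p : ℤ) ∣ x) (hqx : ¬ (q : ℤ) ∣ x) : φ 1 x = 0 := by
  haveI : Fact q.Prime := ⟨hq⟩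
  -- the anchor class: inverse `1`
  obtain ⟨x₁, hx₁, hs₁⟩ := exists_typeP_of_ne_zero hp hq hpq (one_ne_zero : (1 : ZMod q) ≠ 0)
  have key : ∀ z : ℤ, (p : ℤ) ∣ z → ¬ (q : ℤ) ∣ z → φ 1 z = φ 1 x₁ := by
    intro z hz hqz
    have hz0 : (z : ZMod q) ≠ 0 := by rwa [Ne, ZMod.intCast_zmod_eq_zero_iff_dvd]
    have hval : ((z : ZMod q)⁻¹).val = (((z : ZMod q)⁻¹).val - 1) + 1 := by
      have : ((z : ZMod q)⁻¹).val ≠ 0 := by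
        rw [Ne, ZMod.val_eq_zero]; exact inv_ne_zero hz0
      omega
    exact phi_one_typeP_eq_of_val hp hq hpq hN hsmall hφ hB1 hx₁ hs₁ _ z (z : ZMod q)⁻¹ hz (mul_inv_cancel₀ hz0) hval
  have hqp : ¬ (q : ℤ) ∣ (p : ℤ) := fun h ↦ hpq
    (((Nat.prime_dvd_prime_iff_eq hq hp).mp (Int.natCast_dvd_natCast.mp h)).symm)
  rw [key x hx hqx, ← key p (dvd_refl _) hqp, h1p]

/-- **`φ(1, w) = 0` for every `w` at level `pq`** (units: `B₁`; `N ∣ w`: `L_w`; type `p`, type `q`: the chains). [folklore] -/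
theorem phi_one_eq_zero_twoPrimes (hp : p.Prime) (hq : q.Prime) (hpq : p ≠ q) (hN : N = p * q)
    (hadd : ∀ γ δ : Gamma0 N, χ (γ * δ) = χ γ + χ δ)
    (hsmall : ∀ γ : Gamma0 N, ((γ : SL(2, ℤ)) 0 0 + (γ : SL(2, ℤ)) 1 1).natAbs ≤ 2 → χ γ = 0)
    (hφ : ∀ (γ : Gamma0 N) (x y : ℤ), IsCoprime x y →
      φ ((γ : SL(2, ℤ)) 0 0 * x + (γ : SL(2, ℤ)) 0 1 * y) ((γ : SL(2, ℤ)) 1 0 * x + (γ : SL(2, ℤ)) 1 1 * y) = χ γ + φ x y)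
    (hB1 : ∀ β : Gamma0 N, (β : SL(2, ℤ)) 0 1 = -1 → χ β = 0)
    (h01 : φ 0 1 = 0) (h10 : φ 1 0 = 0) (h1p : φ 1 p = 0) (h1q : φ 1 q = 0) (w : ℤ) : φ 1 w = 0 := by
  by_cases hpw : (p : ℤ) ∣ w
  · by_cases hqw : (q : ℤ) ∣ w
    · rw [phi_one_eq_of_dvd hsmall hφ (dvd_level_of_dvd_dvd hp hq hpq hN hpw hqw), h10]
    · exact phi_one_eq_zero_of_dvd_left hp hq hpq hN hsmall hφ hB1 h1p hpw hqw
  · by_cases hqw : (q : ℤ) ∣ w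
    · exact phi_one_eq_zero_of_dvd_left hq hp (Ne.symm hpq) (by rw [hN, mul_comm]) hsmall hφ hB1 h1q hqw hpw
    · rw [phi_one_eq_of_isCoprime hadd hφ hB1 (isCoprime_level_of_not_dvd hp hq hN hpw hqw), h01]

/-! ## §3. The symbol function vanishes on `SL₂(ℤ)` -/

/-- `S(g) = 0` when `d` is prime to `N` (given `φ(1, ·) ≡ 0` and `φ(0,1) = 0`). [cite: Manin1972, §1.5] -/
theorem phi_col_eq_of_isCoprime_right
    (hφ : ∀ (γ : Gamma0 N) (x y : ℤ), IsCoprime x y →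
      φ ((γ : SL(2, ℤ)) 0 0 * x + (γ : SL(2, ℤ)) 0 1 * y) ((γ : SL(2, ℤ)) 1 0 * x + (γ : SL(2, ℤ)) 1 1 * y) = χ γ + φ x y)
    (hone : ∀ w : ℤ, φ 1 w = 0) (h01 : φ 0 1 = 0) (g : SL(2, ℤ)) (hd : IsCoprime (g 1 1) (N : ℤ)) :
    φ (g 0 0) (g 1 0) = φ (g 0 1) (g 1 1) := by
  obtain ⟨w, k, hw⟩ := exists_w_of_isCoprime g hd
  have h := phi_col_zero_eq_of_isCoprime_right hφ g hw
  rw [hone, h01, add_zero] at h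
  rw [add_eq_zero_iff_eq_neg.mp h, CharTwo.neg_eq]

/-- `S(g) = 0` when `c` is prime to `N`. [cite: Manin1972, §1.5] -/
theorem phi_col_eq_of_isCoprime_left
    (hsmall : ∀ γ : Gamma0 N, ((γ : SL(2, ℤ)) 0 0 + (γ : SL(2, ℤ)) 1 1).natAbs ≤ 2 → χ γ = 0)
    (hφ : ∀ (γ : Gamma0 N) (x y : ℤ), IsCoprime x y →
      φ ((γ : SL(2, ℤ)) 0 0 * x + (γ : SL(2, ℤ)) 0 1 * y) ((γ : SL(2, ℤ)) 1 0 * x + (γ : SL(2, ℤ)) 1 1 * y) = χ γ + φ x y)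
    (hone : ∀ w : ℤ, φ 1 w = 0) (h01 : φ 0 1 = 0) (g : SL(2, ℤ)) (hc : IsCoprime (g 1 0) (N : ℤ)) :
    φ (g 0 0) (g 1 0) = φ (g 0 1) (g 1 1) := by
  obtain ⟨a, b, hab⟩ := hc
  have hw : g 1 1 = -(g 1 0) * (-(a * g 1 1)) + N * (b * g 1 1) := by linear_combination -(g 1 1) * hab
  have h := phi_col_zero_eq_of_isCoprime_left hsmall hφ g hw
  rw [hone, h01, add_zero] at h
  rw [add_eq_zero_iff_eq_neg.mp h, CharTwo.neg_eq]

/-- **The symbol function vanishes at level `pq`**: `φ(col₀ g) = φ(col₁ g)` for every `g ∈ SL₂(ℤ)`. The mixed rows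
(`p ∣ d, q ∣ c` or `q ∣ d, p ∣ c`) go through the triangle `gτ = (b, −a−b; d, −c−d)`, `gτ² = (−a−b, a; −c−d, c)`, whose relevant
entry `−c−d` is prime to `N`. [cite: Manin1972, §1.7] -/
theorem phi_col_eq_twoPrimes (hp : p.Prime) (hq : q.Prime) (hN : N = p * q)
    (hsmall : ∀ γ : Gamma0 N, ((γ : SL(2, ℤ)) 0 0 + (γ : SL(2, ℤ)) 1 1).natAbs ≤ 2 → χ γ = 0)
    (hφ : ∀ (γ : Gamma0 N) (x y : ℤ), IsCoprime x y →
      φ ((γ : SL(2, ℤ)) 0 0 * x + (γ : SL(2, ℤ)) 0 1 * y) ((γ : SL(2, ℤ)) 1 0 * x + (γ : SL(2, ℤ)) 1 1 * y) = χ γ + φ x y)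
    (hone : ∀ w : ℤ, φ 1 w = 0) (h01 : φ 0 1 = 0) (g : SL(2, ℤ)) :
    φ (g 0 0) (g 1 0) = φ (g 0 1) (g 1 1) := by
  by_cases hd : ¬ (p : ℤ) ∣ g 1 1 ∧ ¬ (q : ℤ) ∣ g 1 1
  · exact phi_col_eq_of_isCoprime_right hφ hone h01 g (isCoprime_level_of_not_dvd hp hq hN hd.1 hd.2)
  by_cases hc : ¬ (p : ℤ) ∣ g 1 0 ∧ ¬ (q : ℤ) ∣ g 1 0
  · exact phi_col_eq_of_isCoprime_left hsmall hφ hone h01 g (isCoprime_level_of_not_dvd hp hq hN hc.1 hc.2)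
  -- mixed row: `c + d` is prime to `N`
  have hcd : IsCoprime (g 1 0) (g 1 1) := ⟨-(g 0 1), g 0 0, by linear_combination det_entries g⟩
  have key : ∀ {ℓ : ℕ}, ℓ.Prime → ((ℓ : ℤ) ∣ g 1 0 ∨ (ℓ : ℤ) ∣ g 1 1) → ¬ (ℓ : ℤ) ∣ -(g 1 0) - g 1 1 := by
    intro ℓ hℓ hor h
    apply (Nat.prime_iff_prime_int.mp hℓ).not_unit
    rcases hor with h' | h'
    · refine hcd.isUnit_of_dvd' h' ?_
      have := dvd_sub (dvd_neg.mpr h') h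
      rwa [show -(g 1 0) - (-(g 1 0) - g 1 1) = g 1 1 by ring] at this
    · refine hcd.isUnit_of_dvd' ?_ h'
      have := dvd_sub (dvd_neg.mpr h') h
      rwa [show -(g 1 1) - (-(g 1 0) - g 1 1) = g 1 0 by ring] at this
  have hp' : (p : ℤ) ∣ g 1 0 ∨ (p : ℤ) ∣ g 1 1 := by
    by_cases h1 : (p : ℤ) ∣ g 1 0
    · exact Or.inl h1
    by_cases h2 : (p : ℤ) ∣ g 1 1
    · exact Or.inr h2
    exfalso
    have hqd : (q : ℤ) ∣ g 1 1 := by by_contra h; exact hd ⟨h2, h⟩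
    have hqc : (q : ℤ) ∣ g 1 0 := by by_contra h; exact hc ⟨h1, h⟩
    exact (Nat.prime_iff_prime_int.mp hq).not_unit (hcd.isUnit_of_dvd' hqc hqd)
  have hq' : (q : ℤ) ∣ g 1 0 ∨ (q : ℤ) ∣ g 1 1 := by
    by_cases h1 : (q : ℤ) ∣ g 1 0
    · exact Or.inl h1
    by_cases h2 : (q : ℤ) ∣ g 1 1
    · exact Or.inr h2
    exfalso
    have hpd : (p : ℤ) ∣ g 1 1 := by by_contra h; exact hd ⟨h, h2⟩
    have hpc : (p : ℤ) ∣ g 1 0 := by by_contra h; exact hc ⟨h, h1⟩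
    exact (Nat.prime_iff_prime_int.mp hp).not_unit (hcd.isUnit_of_dvd' hpc hpd)
  have hsum : IsCoprime (-(g 1 0) - g 1 1) (N : ℤ) := isCoprime_level_of_not_dvd hp hq hN (key hp hp') (key hq hq')
  -- the two other matrices of the triangle
  obtain ⟨g₁, a00, a01, a10, a11⟩ := exists_sl2_entries (g 0 1) (-(g 0 0) - g 0 1) (g 1 1) (-(g 1 0) - g 1 1)
    (by linear_combination det_entries g)
  obtain ⟨g₂, b00, b01, b10, b11⟩ := exists_sl2_entries (-(g 0 0) - g 0 1) (g 0 0) (-(g 1 0) - g 1 1) (g 1 0)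
    (by linear_combination det_entries g)
  have h₁ := phi_col_eq_of_isCoprime_right hφ hone h01 g₁ (by rw [a11]; exact hsum)
  have h₂ := phi_col_eq_of_isCoprime_left hsmall hφ hone h01 g₂ (by rw [b10]; exact hsum)
  rw [a00, a01, a10, a11] at h₁
  rw [b00, b01, b10, b11] at h₂
  rw [← h₂, ← h₁]

/-! ## §4. The theorem -/

/-- **`B₁`-generation mod 2 at the squarefree two-prime levels.** For distinct primes `p, q` and `N = pq`: an additive
`χ : Γ₀(N) → ZMod 2` killing every element of trace `0, ±1, ±2` (only trace `±2` is used) and every element with upper-right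
entry `−1` vanishes identically. Proof: potential (§1), `φ(1, ·) ≡ 0` (§2), symbol function `≡ 0` (§3), engine §4
(`SL₂(ℤ) = ⟨S, T⟩`). The `𝔽₂`-shadow of Lemma P; replaces the (SUCC) descent at composite level. [cite: Manin1972, Thm. 1.9]
[cite: Rademacher1929, §1] -/
theorem chi_eq_zero_of_forall_b_neg_one_twoPrimes (hp : p.Prime) (hq : q.Prime) (hpq : p ≠ q) (hN : N = p * q)
    (hadd : ∀ γ δ : Gamma0 N, χ (γ * δ) = χ γ + χ δ)
    (hsmall : ∀ γ : Gamma0 N, ((γ : SL(2, ℤ)) 0 0 + (γ : SL(2, ℤ)) 1 1).natAbs ≤ 2 → χ γ = 0)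
    (hB1 : ∀ β : Gamma0 N, (β : SL(2, ℤ)) 0 1 = -1 → χ β = 0) : ∀ γ : Gamma0 N, χ γ = 0 := by
  obtain ⟨φ, hφ, h01, h10, h1p, h1q⟩ := exists_potential_twoPrimes (χ := χ) hp hq hpq hN hadd hsmall
  have hone := phi_one_eq_zero_twoPrimes hp hq hpq hN hadd hsmall hφ hB1 h01 h10 h1p h1q
  exact chi_eq_zero_of_phi_col_eq hsmall hφ (phi_col_eq_twoPrimes hp hq hN hsmall hφ hone h01)

end Potential

end Summit.BirchSwinnertonDyer.BirchSwinnertonDyer.Theorems.SignedMuAtTwo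

end
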